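import Literature.MathematicalPhysics.QuantumFieldTheory.Balaban1983to89.B9Eq315QTorusOnto
import Literature.MathematicalPhysics.QuantumFieldTheory.Balaban1983to89.B7TranslationCovariance

/-!
# `Balaban1983to89.B9Eq315QTower` — T. Bałaban, *Propagators for lattice gauge theories in a background field*, Commun. Math. Phys. **99**
# (1985) 389–434 [Balaban1985BackgroundPropagators] (3.15) p. 393: THE COMPOSITE AVERAGING `Q_k(U) = Q(Ū^{k−1})⋯Q(Ū)Q(U)` ON THE TOWER OF
# TORI `T_{L^k m} → T_{L^{k−1} m} → ⋯ → T_m` as ONE linear map, and its surjectivity in the small-field regime (every factor onto)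

statement-level skeleton of published theorems with citation tags; proofs where landed; nothing here is a claim
about the Yang–Mills mass gap

PDF held: `paper:balaban1985-cmp99-background-propagators` (journal page = PDF page + 388), p. 393; read by this seat (2026-08-21) in the held text.

THE PRINT (verbatim, p. 393).  *«We are interested in the linear operators Q_j(U). They are compositions of j one-step averaging operators
Q_j(U) = Q(Ū^{j−1})…Q(Ū)Q(U), (3.15) where Q(V) is given by the explicit formula (124) in [5].»*  With [Balaban1985Averaging] (43) p. 24 (the
tower `Ū^j`), (1)–(2) p. 17 (the lattices `L^jηℤ^d`, «Ω^{(j)} may be replaced by any other lattice» p. 19).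

WHY THIS FILE (cell context).  `B9Eq315QTorus` (p297270) typed the ONE-STEP factor `Q(V)` on a torus `T_{L·m} → T_m` and `B9Eq315QTorusOnto`
proved it onto in the small-field regime; the assembled operators of the pub-balaban NE9 letter chain were «one averaging level only» (declared
reading (M3) there).  The `k`-th renormalization step sees the COMPOSITE `Q_k(U)` from the `η = L^{−k}`-lattice to the unit lattice.  This file
types the tower of tori `towerP L m n = L^n·m` (so that `towerP L m (n+1) = fineP L (towerP L m n)` DEFINITIONALLY — the one-step factor's
source type at every level), the composite `Qtower` for a family of level backgrounds, and the family `UlevOf k U` of print's averaged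
backgrounds `Ū^j` (`B7Prop2Explicit.avgIter` of the periodic extension, read back on the level tori); surjectivity of the composite is the
composition of the one-step surjectivities.

WHAT IS DEFINED AND PROVED (sorry-free; no `Prop` placeholder; no inequality of the paper).
* §1 `towerP L m n` (`towerP_zero`, `towerP_succ` by `rfl`, `towerP_apply : towerP L m n i = L^n · m i`), `NeZero` instances for `fineP` / `towerP`.
* §2 for a family `Ulev n` of backgrounds on the level-`(n+1)` tori with E162's displayed data (unit-boundedness `hU1 n`, block-loop regularity
  `hreg n` with `α n ≤ 1/64`): **`Qtower … n : (Bond d (towerP L m n) → 𝔸) →ₗ[ℂ] (Bond d m → 𝔸)`** — `Qtower 0 = id`, `Qtower (n+1) = Qtower n ∘ Q(Ulev n)`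
  (`Qtower_zero`, `Qtower_succ` by `rfl`); **`Qtower_surjective`**: in the regime `50(d+1)·α n·L^d ≤ 1/2` at every level the composite is ONTO.
* §3 **`UlevOf k U n`** — print's `Ū^{k−1−n}` for ONE background `U` on the finest torus `T_{L^k m}`: the `(k−1−n)`-fold block average
  ([B7] (42)–(43), `avgIter`) of the periodic extension, read on the level torus; **`QkOfU`** := `Qtower` at this family = `Q_k(U)` of (3.15);
  `QkOfU_surjective`.
* §4 `avgIter_add`, **`linCovIter_add`** (composition law of (127): `Q_{a+b}(V) = Q_b(V̄^a) ∘ Q_a(V)`, un-normalised), periodicity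
  (`shiftCfg_periodVec_perCfg`, `avgIter_perCfg_add_periodVec`, `perCfg_UlevOf`), the one-step factor read on all of `ℤ^d` (`perCfg_QtorusLin`),
  and **`QkOfU_apply_eq_linCovIter`**: `(Q_k(U)A)(c) = (L^k)⁻¹ · (linCovIter L Ũ Ã k)(c̃)` — the printed composite, normalised (READING C-adv4-22).
* §5 the gauge-parameter composite **`QprimeTower`** = `Q′_k` of (3.19) on the same tower (factors E158 `QprimeLin`), **`QprimeTower_surjective`**
  (unconditional).
MODEL / DECLARED READINGS.  (M1) as `B9Eq315QTorus`: levels read on `ℤ^d` through periodic extensions, block corners `L·y`, the one-step factor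
normalised by `L⁻¹` (READING C-adv4-22).  (M2) per-level displayed data: `Ū^j` unit-bounded with `α_j`-regular block loops ([B7] Prop. 2 (52)–(53)
p. 26 — a printed consequence of the small-field condition, NOT proved here) and the smallness `50(d+1)·α_j·L^d ≤ 1/2`.  (M3) §4 IDENTIFIES `QkOfU` with
the NE7c crew's `ℤ^d` composite `linCovIter` ((127)) read periodically (`QkOfU_apply_eq_linCovIter`; one level: `B9Eq315QTorus.QjOp_apply_eq_linCovIter`)
— ONE composite averaging in the tree, now on the tower; the proof uses only the periodicity of the averaged backgrounds
(`B7TranslationCovariance.avgIter_shiftCfg` / `linQcov_shiftCfg`), the composition law `linCovIter_add` and the linearity of `Qtower`.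
HONEST SCOPE.  Type bookkeeping + composition of the one-step theorems; no estimate; NOT summit progress (cell pub-balaban: NE9 NOT PRINTED / NOT
PROVED; spine PROVED 0/9).  Filed by the pub-balaban NE9 BINDER-row owner lineage `b2b-balaban-t4-ne9-p1` (gen 78); NEW file; nothing modified.
Net new unproved facts: 0.
-/

noncomputable section

open scoped BigOperators

namespace Literature.MathematicalPhysics.QuantumFieldTheory.Balaban1983to89.B9Eq315QTower

open B4Sect5Torus (TSite)
open B9SectCLatticeCarrier (Bond)
open B7Prop1Explicit (U1 Wcx boxVec)
open B7Prop2Explicit (avgIter avgIter_zero avgIter_succ)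
open B7Prop3GeneralLinear (linQcov)
open B7Prop4GeneralLevels (linCovIter linCovIter_zero linCovIter_succ)
open B12Ineq417Flat (shiftCfg shiftCfg_apply)
open B7TranslationCovariance (avgIter_shiftCfg linQcov_shiftCfg)
open B7Eq125RightInverse (corner corner_apply corner_add)
open B9Eq319QprimeTorus (fineP)
open B9Eq315QTorus (perSite perCfg perCfg_apply cornerSite QtorusLin QtorusLin_apply)
open B9Eq315QTorusOnto (liftSite periodVec perSite_add_periodVec liftSite_perSite_add perSite_liftSite cornerSite_eq QtorusLin_surjective)

variable {d : ℕ}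

/-! ## §1 The tower of tori `T_{L^n m}` -/

/-- **The periods of the level-`n` torus of the tower over the coarse torus `m`: `L^n·m`**, defined by iterating the one-step refinement
`fineP L` so that `towerP L m (n+1) = fineP L (towerP L m n)` holds by `rfl` («the sequence of lattices L^jηℤ^d», [B7] (1)).
[cite: Balaban1985Averaging, (1)–(2) p.17; Balaban1985BackgroundPropagators, (3.15) p.393] -/
def towerP (L : ℕ) (m : Fin d → ℕ) : ℕ → Fin d → ℕ
  | 0 => m
  | n + 1 => fineP L (towerP L m n)

/-- Level `0` is the coarse torus. [cite: Balaban1985Averaging, (1) p.17] -/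
@[simp] theorem towerP_zero (L : ℕ) (m : Fin d → ℕ) : towerP L m 0 = m := rfl

/-- Level `n+1` refines level `n` by the block size `L` — definitionally the one-step factor's source periods. [cite: Balaban1985Averaging, (1)–(2) p.17] -/
theorem towerP_succ (L : ℕ) (m : Fin d → ℕ) (n : ℕ) : towerP L m (n + 1) = fineP L (towerP L m n) := rfl

/-- `towerP L m n i = L^n · m i`. [cite: Balaban1985Averaging, (1) p.17] -/
theorem towerP_apply (L : ℕ) (m : Fin d → ℕ) : ∀ (n : ℕ) (i : Fin d), towerP L m n i = L ^ n * m i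
  | 0, i => by simp
  | n + 1, i => by rw [towerP_succ, fineP, towerP_apply L m n i, pow_succ]; ring

/-- The refined periods are nonzero. [cite: Balaban1985Averaging, (1)–(2) p.17] -/
instance instNeZeroFineP (L : ℕ) [NeZero L] (P : Fin d → ℕ) [∀ i, NeZero (P i)] (i : Fin d) : NeZero (fineP L P i) :=
  ⟨Nat.mul_ne_zero (NeZero.ne L) (NeZero.ne (P i))⟩

/-- The tower's periods are nonzero. [cite: Balaban1985Averaging, (1)–(2) p.17] -/
instance instNeZeroTowerP (L : ℕ) [NeZero L] (m : Fin d → ℕ) [∀ i, NeZero (m i)] (n : ℕ) (i : Fin d) : NeZero (towerP L m n i) :=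
  ⟨by rw [towerP_apply]; exact Nat.mul_ne_zero (pow_ne_zero _ (NeZero.ne L)) (NeZero.ne (m i))⟩

/-! ## §2 The composite `Q(U_{0}) ∘ ⋯ ∘ Q(U_{n−1})` for a family of level backgrounds -/

section Tower

variable {𝔸 : Type*} [NormedRing 𝔸] [NormedAlgebra ℂ 𝔸] [CompleteSpace 𝔸] [NormOneClass 𝔸]
  (L : ℕ) [NeZero L] (m : Fin d → ℕ) [∀ i, NeZero (m i)] (hL : 1 ≤ L)
  (Ulev : (n : ℕ) → Bond d (towerP L m (n + 1)) → 𝔸ˣ) (α : ℕ → ℝ) (hα1 : ∀ n, α n ≤ 1 / 64)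
  (hU1 : ∀ (n : ℕ) (x : B7Prop1Explicit.Site d) (κ : Fin d), perCfg (towerP L m (n + 1)) (Ulev n) x κ ∈ U1 𝔸)
  (hreg : ∀ (n : ℕ) (y : TSite d (towerP L m n)) (κ : Fin d) (r : Fin d → Fin L),
    ‖((Wcx L (perCfg (towerP L m (n + 1)) (Ulev n)) (cornerSite L y) κ (boxVec L r) : 𝔸ˣ) : 𝔸) - 1‖ ≤ α n)

/-- **THE COMPOSITE AVERAGING OF (3.15) ON THE TOWER**: from the level-`n` torus `T_{L^n m}` down to `T_m`, `Qtower 0 = id`,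
`Qtower (n+1) = Qtower n ∘ Q(Ulev n)` — the finest factor acts first, each factor the one-step `B9Eq315QTorus.QtorusLin` at the level background.
[cite: Balaban1985BackgroundPropagators, (3.15) p.393] -/
def Qtower : (n : ℕ) → ((Bond d (towerP L m n) → 𝔸) →ₗ[ℂ] (Bond d m → 𝔸))
  | 0 => LinearMap.id
  | n + 1 => (Qtower n).comp (QtorusLin L (towerP L m n) hL (Ulev n) (hα1 n) (hU1 n) (hreg n))

/-- `Q_0 = id`. [cite: Balaban1985BackgroundPropagators, (3.15) p.393] -/
@[simp] theorem Qtower_zero : Qtower L m hL Ulev α hα1 hU1 hreg 0 = LinearMap.id := rfl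

/-- `Q_{n+1} = Q_n ∘ Q(U_n)` (finest factor first). [cite: Balaban1985BackgroundPropagators, (3.15) p.393] -/
theorem Qtower_succ (n : ℕ) :
    Qtower L m hL Ulev α hα1 hU1 hreg (n + 1) =
      (Qtower L m hL Ulev α hα1 hU1 hreg n).comp (QtorusLin L (towerP L m n) hL (Ulev n) (hα1 n) (hU1 n) (hreg n)) := rfl

/-- **THE COMPOSITE IS ONTO** when every level is in the small-field regime of `B9Eq315QTorusOnto.QtorusLin_surjective`
(`50(d+1)·α_n·L^d ≤ 1/2`): a composition of surjections. [cite: Balaban1985BackgroundPropagators, (3.15) p.393, (3.126) p.420] -/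
theorem Qtower_surjective (hαL : ∀ n, 50 * (d + 1) * α n * (L : ℝ) ^ d ≤ 1 / 2) :
    ∀ n, Function.Surjective (Qtower L m hL Ulev α hα1 hU1 hreg n)
  | 0 => Function.surjective_id
  | n + 1 => (Qtower_surjective hαL n).comp (QtorusLin_surjective L (towerP L m n) hL (Ulev n) (hα1 n) (hU1 n) (hreg n) (hαL n))

end Tower

/-! ## §3 Print's family `Ū^j` from one background on the finest torus -/

section OneBackground

variable {𝔸 : Type*} [NormedRing 𝔸] [NormedAlgebra ℂ 𝔸] [CompleteSpace 𝔸] [NormOneClass 𝔸]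
  (L : ℕ) [NeZero L] (m : Fin d → ℕ) [∀ i, NeZero (m i)] (hL : 1 ≤ L) (k : ℕ) (U : Bond d (towerP L m k) → 𝔸ˣ)

/-- **`Ū^{k−1−n}` on the level-`(n+1)` torus** (the background of the factor `T_{L^{n+1} m} → T_{L^n m}` of `Q_k(U)`): the `(k−1−n)`-fold block
average (42)–(43) of the periodic extension of `U`, read at the representatives.  (For `n ≥ k` the value is a junk level never composed.)
[cite: Balaban1985Averaging, (42)–(43) pp.23–24; Balaban1985BackgroundPropagators, (3.15) p.393] -/
def UlevOf (n : ℕ) : Bond d (towerP L m (n + 1)) → 𝔸ˣ :=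
  fun b => avgIter L (perCfg (towerP L m k) U) (k - 1 - n) (liftSite b.1) b.2

variable (α : ℕ → ℝ) (hα1 : ∀ n, α n ≤ 1 / 64)
  (hU1 : ∀ (n : ℕ) (x : B7Prop1Explicit.Site d) (κ : Fin d), perCfg (towerP L m (n + 1)) (UlevOf L m k U n) x κ ∈ U1 𝔸)
  (hreg : ∀ (n : ℕ) (y : TSite d (towerP L m n)) (κ : Fin d) (r : Fin d → Fin L),
    ‖((Wcx L (perCfg (towerP L m (n + 1)) (UlevOf L m k U n)) (cornerSite L y) κ (boxVec L r) : 𝔸ˣ) : 𝔸) - 1‖ ≤ α n)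

/-- **`Q_k(U) = Q(Ū^{k−1})⋯Q(Ū)Q(U)` of (3.15)** from the `η = L^{−k}` torus `T_{L^k m}` to the unit torus `T_m`, for ONE background `U`.
[cite: Balaban1985BackgroundPropagators, (3.15) p.393] -/
def QkOfU : (Bond d (towerP L m k) → 𝔸) →ₗ[ℂ] (Bond d m → 𝔸) := Qtower L m hL (UlevOf L m k U) α hα1 hU1 hreg k

/-- **`Q_k(U)` IS ONTO** in the per-level small-field regime. [cite: Balaban1985BackgroundPropagators, (3.15) p.393, (3.126) p.420] -/
theorem QkOfU_surjective (hαL : ∀ n, 50 * (d + 1) * α n * (L : ℝ) ^ d ≤ 1 / 2) : Function.Surjective (QkOfU L m hL k U α hα1 hU1 hreg) :=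
  Qtower_surjective L m hL _ α hα1 hU1 hreg hαL k

end OneBackground

/-! ## §4 ONE composite averaging in the tree: `Q_k(U)` on the tower IS the periodic reading of (127) `linCovIter` -/

section Identification

variable {𝔸 : Type*} [NormedRing 𝔸] [NormedAlgebra ℂ 𝔸] [CompleteSpace 𝔸] [NormOneClass 𝔸]

omit [NormOneClass 𝔸] in
/-- `V̄^{a+b} = \overline{(V̄^a)}^{\,b}` — the tower (43) composes. [cite: Balaban1985Averaging, (43) p.24] -/
theorem avgIter_add (L : ℕ) (V : B7Prop1Explicit.Site d → Fin d → 𝔸ˣ) (a : ℕ) : ∀ b : ℕ, avgIter L V (a + b) = avgIter L (avgIter L V a) b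
  | 0 => rfl
  | b + 1 => by rw [← add_assoc, avgIter_succ, avgIter_succ, avgIter_add L V a b]

omit [NormOneClass 𝔸] in
/-- **Composition law of (127)**: `Q_{a+b}(V)B = Q_b(V̄^a)(Q_a(V)B)` for the un-normalised composite linear parts — «Q_j(U) = Q(Ū^{j−1})⋯Q(U)»
regrouped. [cite: Balaban1985Averaging, (127) p.37; Balaban1985BackgroundPropagators, (3.15) p.393] -/
theorem linCovIter_add (L : ℕ) (V : B7Prop1Explicit.Site d → Fin d → 𝔸ˣ) (B : B7Prop1Explicit.Site d → Fin d → 𝔸) (a : ℕ) :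
    ∀ b : ℕ, linCovIter L V B (a + b) = linCovIter L (avgIter L V a) (linCovIter L V B a) b
  | 0 => rfl
  | b + 1 => by
    funext z κ
    rw [← add_assoc, linCovIter_succ, linCovIter_succ, linCovIter_add L V B a b, avgIter_add]

variable (P : Fin d → ℕ) [∀ i, NeZero (P i)]

/-- A periodic extension is invariant under translation by its periods. [cite: Balaban1985Averaging, (1) p.17] -/
theorem shiftCfg_periodVec_perCfg {V : Type*} (W : Bond d P → V) (t : B7Prop1Explicit.Site d) :
    shiftCfg (periodVec P t) (perCfg P W) = perCfg P W := by
  funext x κ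
  rw [shiftCfg_apply, perCfg_apply, perCfg_apply, perSite_add_periodVec]

omit [∀ i, NeZero (P i)] in
/-- `periodVec` of the negated multi-index. [cite: Balaban1985Averaging, (1) p.17] -/
theorem periodVec_neg (t : B7Prop1Explicit.Site d) : periodVec P (-t) = -periodVec P t := by
  funext i; simp [periodVec]

variable (L : ℕ) [NeZero L] (m : Fin d → ℕ) [∀ i, NeZero (m i)]

omit [∀ i, NeZero (P i)] [NeZero L] [∀ i, NeZero (m i)] in
/-- The periods of the level-`k` torus are `L^j` times those of level `k − j`. [cite: Balaban1985Averaging, (1)–(2) p.17] -/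
theorem smul_periodVec_towerP {j k : ℕ} (hj : j ≤ k) (t : B7Prop1Explicit.Site d) :
    ((L : ℤ) ^ j) • periodVec (towerP L m (k - j)) t = periodVec (towerP L m k) t := by
  funext i
  simp only [Pi.smul_apply, periodVec, towerP_apply, smul_eq_mul, Nat.cast_mul, Nat.cast_pow]
  rw [show k = j + (k - j) by omega, pow_add, Nat.add_sub_cancel_left]
  ring

omit [NormOneClass 𝔸] [∀ i, NeZero (P i)] in
/-- **The averaged backgrounds of a periodic background are periodic**: `Ū^j` of the extension of `U` on `T_{L^k m}` has the periods of
`T_{L^{k−j} m}` (translation covariance `B7TranslationCovariance.avgIter_shiftCfg`). [cite: Balaban1985Averaging, (43) p.24, (1)–(2) p.17] -/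
theorem avgIter_perCfg_add_periodVec {j k : ℕ} (hj : j ≤ k) (U : Bond d (towerP L m k) → 𝔸ˣ) (t z : B7Prop1Explicit.Site d) (κ : Fin d) :
    avgIter L (perCfg (towerP L m k) U) j (z + periodVec (towerP L m (k - j)) t) κ = avgIter L (perCfg (towerP L m k) U) j z κ := by
  rw [avgIter_shiftCfg, smul_periodVec_towerP L m hj, shiftCfg_periodVec_perCfg]

omit [NormOneClass 𝔸] [∀ i, NeZero (P i)] in
/-- **The level background `UlevOf k U n` read on `ℤ^d` IS `Ū^{k−1−n}`.** [cite: Balaban1985Averaging, (43) p.24; Balaban1985BackgroundPropagators, (3.15) p.393] -/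
theorem perCfg_UlevOf {k n : ℕ} (hn : n + 1 ≤ k) (U : Bond d (towerP L m k) → 𝔸ˣ) :
    perCfg (towerP L m (n + 1)) (UlevOf L m k U n) = avgIter L (perCfg (towerP L m k) U) (k - 1 - n) := by
  funext x κ
  rw [perCfg_apply, UlevOf]
  conv_rhs => rw [← liftSite_perSite_add (towerP L m (n + 1)) x]
  rw [show n + 1 = k - (k - 1 - n) by omega, avgIter_perCfg_add_periodVec L m (by omega)]

omit [∀ i, NeZero (P i)] [NeZero L] [∀ i, NeZero (m i)] in
/-- the block corner of an integer site is the `L`-dilate: `corner L z = L•z`. [cite: Balaban1985Averaging, (2) p.17] -/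
theorem corner_eq_smul (z : B7Prop1Explicit.Site d) : corner L z = (L : ℤ) • z := by
  funext i; simp [corner_apply]

omit [∀ i, NeZero (P i)] [NeZero L] [∀ i, NeZero (m i)] in
/-- `corner` of a period vector of `P` is a period vector of the refined torus `fineP L P`. [cite: Balaban1985Averaging, (1)–(2) p.17] -/
theorem corner_periodVec (t : B7Prop1Explicit.Site d) : corner L (periodVec P t) = periodVec (fineP L P) t := by
  funext i; simp only [corner_apply, periodVec, fineP, Nat.cast_mul]; ring

variable (hL : 1 ≤ L)

/-- **The one-step factor read on all of `ℤ^d`**: the periodic extension of `Q(V)A` (E162 `QtorusLin` on `T_{L·P} → T_P`) is `L⁻¹ ·` the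
`ℤ^d` linear part (122) of the extended data at the dilated sites `L•z` — for EVERY `z`, not only the representatives (periodicity of
`linQcov`, `B7TranslationCovariance.linQcov_shiftCfg`). [cite: Balaban1985Averaging, (122) p.36, (1) p.17; Balaban1985BackgroundPropagators, (3.15) p.393] -/
theorem perCfg_QtorusLin (V : Bond d (fineP L P) → 𝔸ˣ) {α : ℝ} (hα1 : α ≤ 1 / 64)
    (hV1 : ∀ (x : B7Prop1Explicit.Site d) (κ : Fin d), perCfg (fineP L P) V x κ ∈ U1 𝔸)
    (hreg : ∀ (y : TSite d P) (κ : Fin d) (r : Fin d → Fin L),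
      ‖((Wcx L (perCfg (fineP L P) V) (cornerSite L y) κ (boxVec L r) : 𝔸ˣ) : 𝔸) - 1‖ ≤ α)
    (A : Bond d (fineP L P) → 𝔸) (z : B7Prop1Explicit.Site d) (κ : Fin d) :
    perCfg P (QtorusLin L P hL V hα1 hV1 hreg A) z κ =
      ((L : ℂ))⁻¹ • linQcov L (perCfg (fineP L P) V) (perCfg (fineP L P) A) ((L : ℤ) • z) κ := by
  rw [perCfg_apply, QtorusLin_apply, cornerSite_eq, ← corner_eq_smul]
  congr 1
  set t : B7Prop1Explicit.Site d := fun i => z i / (P i : ℤ) with ht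
  have hz : corner L (liftSite (perSite P z)) = corner L z + periodVec (fineP L P) (-t) := by
    conv_rhs => rw [← liftSite_perSite_add P z]
    rw [corner_add, corner_periodVec, periodVec_neg, add_neg_cancel_right]
  rw [hz, ← linQcov_shiftCfg L (periodVec (fineP L P) (-t)), shiftCfg_periodVec_perCfg, shiftCfg_periodVec_perCfg]

variable (k : ℕ) (U : Bond d (towerP L m k) → 𝔸ˣ) (α : ℕ → ℝ) (hα1 : ∀ n, α n ≤ 1 / 64)
  (hU1 : ∀ (n : ℕ) (x : B7Prop1Explicit.Site d) (κ : Fin d), perCfg (towerP L m (n + 1)) (UlevOf L m k U n) x κ ∈ U1 𝔸)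
  (hreg : ∀ (n : ℕ) (y : TSite d (towerP L m n)) (κ : Fin d) (r : Fin d → Fin L),
    ‖((Wcx L (perCfg (towerP L m (n + 1)) (UlevOf L m k U n)) (cornerSite L y) κ (boxVec L r) : 𝔸ˣ) : 𝔸) - 1‖ ≤ α n)

/-- **The tower composite at depth `n ≤ k` is the periodic reading of (127)** at the background `Ū^{k−n}`:
`(Qtower n A)(c) = (L^n)⁻¹ · linCovIter L Ū^{k−n} Ã n (c̃)`. [cite: Balaban1985Averaging, (127) p.37; Balaban1985BackgroundPropagators, (3.15) p.393] -/
theorem Qtower_UlevOf_apply : ∀ {n : ℕ}, n ≤ k → ∀ (A : Bond d (towerP L m n) → 𝔸) (c : Bond d m),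
    Qtower L m hL (UlevOf L m k U) α hα1 hU1 hreg n A c =
      (((L : ℂ) ^ n))⁻¹ • linCovIter L (avgIter L (perCfg (towerP L m k) U) (k - n)) (perCfg (towerP L m n) A) n (liftSite c.1) c.2
  | 0, _, A, c => by
    obtain ⟨y, κ⟩ := c
    simp only [Qtower_zero, pow_zero, inv_one, one_smul, linCovIter_zero, towerP_zero, perCfg_apply, perSite_liftSite]
    rfl
  | n + 1, hn, A, c => by
    set V := perCfg (towerP L m (n + 1)) (UlevOf L m k U n) with hV
    set At := perCfg (towerP L m (n + 1)) A with hAt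
    -- the one-step output, un-normalised
    set X : Bond d (towerP L m n) → 𝔸 := fun b => linQcov L V At (cornerSite L b.1) b.2 with hX
    have hQA : QtorusLin L (towerP L m n) hL (UlevOf L m k U n) (hα1 n) (hU1 n) (hreg n) A = ((L : ℂ))⁻¹ • X := by
      funext b; rw [Pi.smul_apply, QtorusLin_apply]; rfl
    have hXper : perCfg (towerP L m n) X = linCovIter L V At 1 := by
      funext z κ'
      have h := perCfg_QtorusLin (towerP L m n) L hL (UlevOf L m k U n) (hα1 n) (hU1 n) (hreg n) A z κ'
      rw [hQA] at h
      have h' : perCfg (towerP L m n) (((L : ℂ))⁻¹ • X) z κ' = ((L : ℂ))⁻¹ • perCfg (towerP L m n) X z κ' := rfl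
      rw [h'] at h
      have hL0 : ((L : ℂ))⁻¹ ≠ 0 := inv_ne_zero (by exact_mod_cast (NeZero.ne L))
      rw [show linCovIter L V At 1 z κ' = linQcov L V At ((L : ℤ) • z) κ' from rfl]
      exact smul_right_injective _ hL0 h
    have hstep : Qtower L m hL (UlevOf L m k U) α hα1 hU1 hreg (n + 1) A c =
        ((L : ℂ))⁻¹ • Qtower L m hL (UlevOf L m k U) α hα1 hU1 hreg n X c := by
      show Qtower L m hL (UlevOf L m k U) α hα1 hU1 hreg n
          (QtorusLin L (towerP L m n) hL (UlevOf L m k U n) (hα1 n) (hU1 n) (hreg n) A) c = _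
      rw [hQA, map_smul, Pi.smul_apply]
    rw [hstep, Qtower_UlevOf_apply (Nat.le_of_succ_le hn) X c, hXper, hV, perCfg_UlevOf L m hn,
      show k - n = k - 1 - n + 1 by omega, avgIter_add, ← linCovIter_add, smul_smul, ← mul_inv, ← pow_succ', add_comm 1 n,
      show k - (n + 1) = k - 1 - n by omega]

/-- **`Q_k(U)` OF (3.15) ON THE TOWER IS THE PERIODIC READING OF THE NE7c CREW'S COMPOSITE (127)**: `(Q_k(U)A)(c) = (L^k)⁻¹ · (linCovIter L Ũ Ã k)(c̃)`
— ONE composite averaging in the tree (E162's one-level `QjOp_apply_eq_linCovIter` on the whole tower), print's `Q_k(U)` normalised per READING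
C-adv4-22. [cite: Balaban1985BackgroundPropagators, (3.15) p.393; Balaban1985Averaging, (127) p.37] -/
theorem QkOfU_apply_eq_linCovIter (A : Bond d (towerP L m k) → 𝔸) (c : Bond d m) :
    QkOfU L m hL k U α hα1 hU1 hreg A c =
      (((L : ℂ) ^ k))⁻¹ • linCovIter L (perCfg (towerP L m k) U) (perCfg (towerP L m k) A) k (liftSite c.1) c.2 := by
  rw [QkOfU, Qtower_UlevOf_apply L m hL k U α hα1 hU1 hreg le_rfl, Nat.sub_self, avgIter_zero]

end Identification

/-! ## §5 The gauge-parameter composite `Q′_k(U) = Q′(Ū^{k−1})⋯Q′(U)` of (3.19) on the same tower -/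

section QprimeTower

open B9Eq319QprimeTorus (QprimeLin QprimeLin_surjective)

variable {V : Type*} [AddCommGroup V] [Module ℂ V] (L : ℕ) [NeZero L] (m : Fin d → ℕ)
  (Rlev : (n : ℕ) → Bond d (towerP L m (n + 1)) → V →ₗ[ℂ] V)

/-- **THE COMPOSITE `Q′_k(U) = Q′(Ū^{k−1})·…·Q′(Ū)Q′(U)` OF (3.19) ON THE TOWER** for a family of level transporter data (print:
`R(Ū^j(Γ_{y,x}))`): `QprimeTower 0 = id`, `QprimeTower (n+1) = QprimeTower n ∘ Q′(Rlev n)`, each factor E158's `QprimeLin`.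
[cite: Balaban1985BackgroundPropagators, (3.19) p.393] -/
def QprimeTower : (n : ℕ) → ((TSite d (towerP L m n) → V) →ₗ[ℂ] (TSite d m → V))
  | 0 => LinearMap.id
  | n + 1 => (QprimeTower n).comp (QprimeLin L (towerP L m n) (Rlev n))

/-- `Q′_0 = id`. [cite: Balaban1985BackgroundPropagators, (3.19) p.393] -/
@[simp] theorem QprimeTower_zero : QprimeTower L m Rlev 0 = LinearMap.id := rfl

/-- `Q′_{n+1} = Q′_n ∘ Q′(R_n)` (finest factor first). [cite: Balaban1985BackgroundPropagators, (3.19) p.393] -/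
theorem QprimeTower_succ (n : ℕ) :
    QprimeTower L m Rlev (n + 1) = (QprimeTower L m Rlev n).comp (QprimeLin L (towerP L m n) (Rlev n)) := rfl

/-- **`Q′_k` IS ONTO, unconditionally** (every factor is, `B9Eq319QprimeTorus.QprimeLin_surjective`) — the hypothesis behind `(Q′G′²Q′*)⁻¹`
of (3.25) at every number of levels. [cite: Balaban1985BackgroundPropagators, (3.19) p.393, (3.25) p.394] -/
theorem QprimeTower_surjective : ∀ n, Function.Surjective (QprimeTower L m Rlev n)
  | 0 => Function.surjective_id
  | n + 1 => (QprimeTower_surjective n).comp (QprimeLin_surjective L (towerP L m n) (Rlev n))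

end QprimeTower

end Literature.MathematicalPhysics.QuantumFieldTheory.Balaban1983to89.B9Eq315QTower

end
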